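import Summits.HodgeConjecture.HodgeConjecture.Theorems.K2LiuInertCartanIwasawaBlocks

/-!
# `Λ_{s,v}` on the Cartan representatives at an INERT place — the closed form (LOCAL SEAM of s23, inert package, file #27i)

Track B ∕ K2-LIT, hLiu418 = stmt-HodgeConjecture-24832; LEAD F0P6-plan (g10) deal 2026-09-04 02:26:33Z (inert package → K2Liu-p01), words
`K2/K2Liu-p01/g3/INERT-SOCKETS-v2.K2Liup01g3.md` §0. Helper (count-neutral, own head per LEAD R3): the inert twin of ★ #27
`K2LiuUnramifiedSectionOnCartan.lambdaLoc_iotaLeftLocPi_diagonal_split`. For the K2Lit CURVE datum `(L, e : Fin 2 × Fin 1 ≃ Fin n, dV, dW)`,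
a finite place `v` of `L⁺` INERT in `L` (`w ∣ v`, `c w = w`), a Hecke character `χ` of `L` unramified above `v`, a `σ_w`-fixed uniformizer `ϖ`
of `L_w` (e.g. `ϖ_v`, `v` unramified), a hyperbolic integral frame `T ∈ GL₂(𝒪_w)` of the place form (`diag(dV)_w = σ_w(T)ᵀ · antidiag(1,1) · T`,
★ `exists_glInt_placeForm_eq_formCongr_antidiagonal`) and `t ∈ G_v = U(V)(L⁺_v)` whose `w`-component is `T⁻¹ · diag(ϖ^m, ϖ^{-m}) · T` (`m : ℕ`):

  `Λ_{s,v}(ι_v(t, 1)) = χ(ϖ_w)^m · ‖ϖ‖_w^{m (s + n/2)}`   (`‖ϖ‖_w = q_w⁻¹ = q_v⁻²`, `n = 2`)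

(`lambdaLoc_iotaLeftLocPi_cartan_inert`). PROOF (explicit Iwasawa decomposition `ι_v(t,1) = p·k` in the doubled group `U(𝕎 ⊕ −𝕎)(L⁺_v)`,
no case split): in the hyperbolic frame the two doubled lines `⟨e, e⁻⟩`, `⟨f, f⁻⟩` (`e, f` the hyperbolic pair) are Lagrangians in duality,
so the per-line `2 × 2` blocks `κ₀ = [[a+1, −1], [1, 0]]` (line of `e`, `a = ϖ^m`, the `|a| ≤ 1` block of ★ `K2LiuSplitCartanIwasawa`) and its
`h'`-dual `κ₁ = [[0, 1], [−1, a+1]]` (line of `f`) assemble to an integral unitary `k`; `p := ι_v(t,1)·k⁻¹` has per-line blocks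
`[[0, a], [−1, a+1]]`, `[[(a+1)/a, −1/a], [1, 0]]`, lies in `P_Δ` with `det_Δ p = a = ϖ^m`; then ★ `lambdaLoc_mul_eq` + ★
`siegelCharLoc_eq_localSiegelCharacter_of_mem` + one place above `v` + ★ `coe_map_localUnits_eq_valueAtUniformizer_zpow`.
[Li1992, §3 Thm. 3.1]; [GelbartPiatetskishapiroRallis1987, Part A §6]; [Liu2011, §2C (2-4) p. 863]. No `def`, no `sorry`.
HONEST LABEL: HC_CM is proved only modulo the printed citations (2 remaining named inputs: hLiu418 = stmt-HodgeConjecture-24832,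
h413 = stmt-HodgeConjecture-24833) until rung 0 closes; this file is unconditional and moves no counter.
-/

set_option autoImplicit false

set_option linter.dupNamespace false

noncomputable section

open scoped Matrix Kronecker
open NumberField IsDedekindDomain Matrix

namespace Summit.HodgeConjecture.HodgeConjecture.Cruxes.HLiu418.K2LiuUnramifiedSectionOnCartanInert

open Literature.NumberTheory.Automorphic Literature.NumberTheory.Automorphic.UnitaryGroup Literature.NumberTheory.GaloisRepresentations
open Literature.NumberTheory.GelbartRogawski1991 Literature.NumberTheory.GelbartRogawski1991.GRConstruction
open Literature.NumberTheory.GelbartRogawski1991.UnitaryDualPair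
open Literature.NumberTheory.K2Lit Literature.NumberTheory.K2Lit.SiegelDoubled
open Summit.HodgeConjecture.HodgeConjecture.Cruxes.HLiu418.K2LiuSplitCartanIwasawa
open Summit.HodgeConjecture.HodgeConjecture.Cruxes.HLiu418.K2LiuUnramifiedSectionOnCartan
open Summit.HodgeConjecture.HodgeConjecture.Cruxes.HLiu418.K2LiuInertCartanIwasawaBlocks

variable (L : Type) [Field L] [NumberField L] [IsCMField L]
variable {n : ℕ} (e : Fin 2 × Fin 1 ≃ Fin n)
  (dV : Fin 2 → L) (hdV : ∀ i, IsCMField.complexConj L (dV i) = dV i)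
  (dW : Fin 1 → L) (hdW : ∀ i, IsCMField.complexConj L (dW i) = dW i)
  (v : HeightOneSpectrum (𝓞 (Fp L)))

set_option maxHeartbeats 400000 in -- measured 2026-09-04: the default 200000 times out at `whnf` on the `p·k` telescope read through `localPiNonsplitEquiv`; 400000 passes
/-- **`Λ_{s,v}` on the Cartan representatives at an inert place** (inert package, #27i): for `t ∈ G_v` with
`t_w = T⁻¹ · diag(ϖ^m, ϖ^{-m}) · T` in a hyperbolic integral frame `T` of the place form at the inert place `w ∣ v`,
`Λ_{s,v}(ι_v(t, 1)) = χ(ϖ_w)^m · ‖ϖ‖_w^{m (s + n/2)}`.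
[cite: Li1992, §3 Thm. 3.1] [cite: GelbartPiatetskishapiroRallis1987, Part A §6] [cite: Liu2011, §2C p. 863] -/
theorem lambdaLoc_iotaLeftLocPi_cartan_inert (χ : HeckeCharacter L) (s : ℂ)
    (hχ : ∀ w : UnitaryGroup.PlacesOver L v, χ.IsUnramifiedAt w.1)
    (w : UnitaryGroup.PlacesOver L v) (hw : IsCMField.complexConj L • w.1 = w.1)
    {ϖ : w.1.adicCompletion L} (hϖ : Valued.v ϖ = WithZero.exp (-1 : ℤ))
    (hϖσ : galAdicCompletionMap (L := L) (IsCMField.complexConj L) hw ϖ = ϖ)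
    (T : GL (Fin 2) (w.1.adicCompletion L)) (hTi : T ∈ glInt 2 (w.1.adicCompletion L))
    (hTJ : UnitaryGroup.placeForm (Matrix.diagonal dV) w.1 =
      formCongr (galAdicCompletionMap (L := L) (IsCMField.complexConj L) hw) T ((StdForm.antidiagonal 2).over (w.1.adicCompletion L)))
    (m : ℕ) (t : UnitaryGroup.localPi L (IsCMField.complexConj L) 2 (Matrix.diagonal dV) v)
    (ht : Units.val ((t : UnitaryGroup.LocalGLPi L 2 v) w) =
      ((T⁻¹ : GL (Fin 2) (w.1.adicCompletion L)) : Matrix (Fin 2) (Fin 2) (w.1.adicCompletion L)) *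
        Matrix.diagonal ![ϖ ^ m, (ϖ ^ m)⁻¹] * (T : Matrix (Fin 2) (Fin 2) (w.1.adicCompletion L))) :
    LambdaLoc L e dV hdV dW hdW v χ s (iotaLeftLocPi L e dV hdV dW hdW v t) =
      χ.valueAtUniformizer w.1 ^ m * ((‖ϖ‖ ^ m : ℝ) : ℂ) ^ (s + (n : ℂ) / 2) := by
  classical
  haveI : Algebra.IsQuadraticExtension (Fp L) L := IsCMField.isQuadraticExtension L
  have hc : IsCMField.complexConj L ≠ 1 := IsCMField.complexConj_ne_one L
  have hϖ0 : ϖ ≠ 0 := fun h0 => by rw [h0, map_zero] at hϖ; exact WithZero.exp_ne_zero hϖ.symm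
  -- shorthand: the conjugation `σ` of `L_w`, the eigenvalue `a = ϖ^m`, the line enumeration `eL`
  set σ : w.1.adicCompletion L →+* w.1.adicCompletion L := galAdicCompletionMap (L := L) (IsCMField.complexConj L) hw with hσ
  set a : w.1.adicCompletion L := ϖ ^ m with ha_def
  have ha : a ≠ 0 := pow_ne_zero _ hϖ0
  have hσa : σ a = a := by rw [ha_def, map_pow, hϖσ]
  set eL : Fin n ≃ Fin 2 := e.symm.trans (Equiv.prodUnique (Fin 2) (Fin 1)) with heL
  -- the frame blocks `T' = T`, `T'⁻¹` enumerated along the lines, and the frames `T' ⊕ T'`, `T'⁻¹ ⊕ T'⁻¹`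
  set T' : Matrix (Fin n) (Fin n) (w.1.adicCompletion L) := (T : Matrix (Fin 2) (Fin 2) (w.1.adicCompletion L)).submatrix eL eL with hT'
  set Ti : Matrix (Fin n) (Fin n) (w.1.adicCompletion L) := ((T⁻¹ : GL (Fin 2) (w.1.adicCompletion L)) : Matrix (Fin 2) (Fin 2) (w.1.adicCompletion L)).submatrix eL eL with hTi'
  have hTT : T' * Ti = 1 := by
    rw [hT', hTi', Matrix.submatrix_mul_equiv, ← Units.val_mul, mul_inv_cancel, Units.val_one, Matrix.submatrix_one_equiv]
  have hTT' : Ti * T' = 1 := by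
    rw [hT', hTi', Matrix.submatrix_mul_equiv, ← Units.val_mul, inv_mul_cancel, Units.val_one, Matrix.submatrix_one_equiv]
  set Tb : Matrix (Fin (n + n)) (Fin (n + n)) (w.1.adicCompletion L) := Matrix.reindex (LocalSplitting.e₂ n) (LocalSplitting.e₂ n) (Matrix.fromBlocks T' 0 0 T') with hTb
  set Tbi : Matrix (Fin (n + n)) (Fin (n + n)) (w.1.adicCompletion L) := Matrix.reindex (LocalSplitting.e₂ n) (LocalSplitting.e₂ n) (Matrix.fromBlocks Ti 0 0 Ti)
    with hTbi
  have hTb1 : ∀ X : Matrix (Fin (n + n)) (Fin (n + n)) (w.1.adicCompletion L), Tb * (Tbi * X) = X := fun X => by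
    rw [← Matrix.mul_assoc, hTb, hTbi, frame_mul_frame, hTT, reindex_fromBlocks_one_one, Matrix.one_mul]
  have hTb2 : ∀ X : Matrix (Fin (n + n)) (Fin (n + n)) (w.1.adicCompletion L), Tbi * (Tb * X) = X := fun X => by
    rw [← Matrix.mul_assoc, hTb, hTbi, frame_mul_frame, hTT', reindex_fromBlocks_one_one, Matrix.one_mul]
  -- the matrices `k`, `k⁻¹` and the form `J' ⊕ −J'` in the hyperbolic frame
  set Km : Matrix (Fin (n + n)) (Fin (n + n)) (w.1.adicCompletion L) := Matrix.reindex (LocalSplitting.e₂ n) (LocalSplitting.e₂ n)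
    (Matrix.fromBlocks (diagonal fun j => ![a + 1, 0] (eL j)) (diagonal fun j => ![-1, 1] (eL j))
      (diagonal fun j => ![1, -1] (eL j)) (diagonal fun j => ![0, a + 1] (eL j))) with hKm
  set Lm : Matrix (Fin (n + n)) (Fin (n + n)) (w.1.adicCompletion L) := Matrix.reindex (LocalSplitting.e₂ n) (LocalSplitting.e₂ n)
    (Matrix.fromBlocks (diagonal fun j => ![0, a + 1] (eL j)) (diagonal fun j => ![1, -1] (eL j))
      (diagonal fun j => ![-1, 1] (eL j)) (diagonal fun j => ![a + 1, 0] (eL j))) with hLm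
  set Jm : Matrix (Fin (n + n)) (Fin (n + n)) (w.1.adicCompletion L) := Matrix.reindex (LocalSplitting.e₂ n) (LocalSplitting.e₂ n)
    (Matrix.fromBlocks (((StdForm.antidiagonal 2).over (w.1.adicCompletion L)).submatrix eL eL) 0 0 (-((StdForm.antidiagonal 2).over (w.1.adicCompletion L)).submatrix eL eL)) with hJm
  have hKL1 : ∀ X : Matrix (Fin (n + n)) (Fin (n + n)) (w.1.adicCompletion L), Km * (Lm * X) = X := fun X => by
    rw [← Matrix.mul_assoc, hKm, hLm, kMat_mul_lMat, Matrix.one_mul]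
  have hLK : Lm * Km = 1 := mul_eq_one_comm.1 (by rw [hKm, hLm]; exact kMat_mul_lMat eL a)
  have hLK1 : ∀ X : Matrix (Fin (n + n)) (Fin (n + n)) (w.1.adicCompletion L), Lm * (Km * X) = X := fun X => by
    rw [← Matrix.mul_assoc, hLK, Matrix.one_mul]
  have hKu1 : ∀ X : Matrix (Fin (n + n)) (Fin (n + n)) (w.1.adicCompletion L), Kmᵀ * (Jm * (Km * X)) = Jm * X := fun X => by
    rw [← Matrix.mul_assoc, ← Matrix.mul_assoc, hKm, hJm, kMat_transpose_mul_form_mul_kMat]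
  have hKσ : Km.map σ = Km := by
    have h1 : ∀ f : Fin 2 → (w.1.adicCompletion L), (∀ i, σ (f i) = f i) → (diagonal fun j => f (eL j)).map σ = diagonal fun j => f (eL j) := by
      intro f hf
      rw [Matrix.diagonal_map (map_zero σ)]
      exact congrArg diagonal (funext fun j => hf (eL j))
    have hs : ∀ i : Fin 2, σ (![a + 1, 0] i) = ![a + 1, 0] i ∧ σ (![-1, 1] i) = ![-1, 1] i ∧ σ (![1, -1] i) = ![1, -1] i ∧
        σ (![0, a + 1] i) = ![0, a + 1] i := by
      intro i; fin_cases i <;> simp [hσa]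
    rw [hKm, Matrix.reindex_apply, ← Matrix.submatrix_map, Matrix.fromBlocks_map, h1 _ fun i => (hs i).1, h1 _ fun i => (hs i).2.1,
      h1 _ fun i => (hs i).2.2.1, h1 _ fun i => (hs i).2.2.2]
  -- the `GL` element `k_w = Tbi · Km · Tb`
  let Kgl : GL (Fin (n + n)) (w.1.adicCompletion L) :=
    ⟨Tbi * Km * Tb, Tbi * Lm * Tb, by simp only [Matrix.mul_assoc, hTb1, hKL1]; simpa only [Matrix.mul_one] using hTb2 1,
      by simp only [Matrix.mul_assoc, hTb1, hLK1]; simpa only [Matrix.mul_one] using hTb2 1⟩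
  -- the doubled form at `w` in the hyperbolic frame: `J^𝔻_w = dW₀ · (σ Tb)ᵀ (J' ⊕ −J') Tb`
  have hPF : UnitaryGroup.placeForm (hermD L e dV hdV dW hdW) w.1 = algebraMap L (w.1.adicCompletion L) (dW 0) • ((Tb.map σ)ᵀ * Jm * Tb) := by
    have hblk : ∀ (c : w.1.adicCompletion L) (X : Matrix (Fin n) (Fin n) (w.1.adicCompletion L)),
        Matrix.fromBlocks (c • X) 0 0 (-(c • X)) = c • Matrix.fromBlocks X 0 0 (-X) := by
      intro c X; rw [Matrix.fromBlocks_smul, smul_zero, smul_neg]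
    rw [hTb, hJm, frame_transpose_mul_form_mul_frame, LocalSplitting.placeForm_eq (Fp L) L v n (hermD_eq_map_gramD L e dV hdV dW hdW) w,
      gramW_eq_smul_frame L e dV hdV dW hdW v w hw T hTJ, ← hσ, ← heL, ← hT', hblk, Matrix.reindex_apply, Matrix.reindex_apply,
      Matrix.submatrix_smul, Pi.smul_apply, Pi.smul_apply]
  have hTbTbi : Tb * Tbi = 1 := by simpa only [Matrix.mul_one] using hTb1 1
  have hσT : ∀ X : Matrix (Fin (n + n)) (Fin (n + n)) (w.1.adicCompletion L), (Tbi.map σ)ᵀ * ((Tb.map σ)ᵀ * X) = X := fun X => by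
    rw [← Matrix.mul_assoc, ← Matrix.transpose_mul, ← Matrix.map_mul, hTbTbi, Matrix.map_one σ (map_zero σ) (map_one σ), Matrix.transpose_one,
      Matrix.one_mul]
  have hKU : Kgl ∈ unitaryGroupOfForm σ (UnitaryGroup.placeForm (hermD L e dV hdV dW hdW) w.1) := by
    rw [mem_unitaryGroupOfForm_iff]
    change ((Tbi * Km * Tb).map σ)ᵀ * UnitaryGroup.placeForm (hermD L e dV hdV dW hdW) w.1 * (Tbi * Km * Tb) = _
    rw [hPF, Matrix.map_mul, Matrix.map_mul, hKσ, Matrix.transpose_mul, Matrix.transpose_mul, Matrix.mul_smul, Matrix.smul_mul]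
    congr 1
    simp only [Matrix.mul_assoc, hTb1, hσT, hKu1]
  -- the element `k ∈ K_{H,v}` through the one-place model
  let k : UnitaryGroup.localPi L (IsCMField.complexConj L) (n + n) (hermD L e dV hdV dW hdW) v :=
    (localPiNonsplitEquiv (IsCMField.complexConj L) (hermD L e dV hdV dW hdW) hc w hw).symm ⟨Kgl, hKU⟩
  have hkw : (k : UnitaryGroup.LocalGLPi L (n + n) v) w = Kgl := by
    have h1 := coe_localPiNonsplitEquiv_apply (IsCMField.complexConj L) (hermD L e dV hdV dW hdW) hc w hw k
    rw [ContinuousMulEquiv.apply_symm_apply] at h1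
    exact h1.symm
  have hKinv : ((Kgl⁻¹ : GL (Fin (n + n)) (w.1.adicCompletion L)) : Matrix (Fin (n + n)) (Fin (n + n)) (w.1.adicCompletion L)) = Tbi * Lm * Tb := rfl
  -- integrality of `k_w` and `k_w⁻¹`
  have hva' : ValuativeRel.valuation (w.1.adicCompletion L) a ≤ 1 := by
    rw [ha_def, ← zpow_natCast]; exact (valuation_zpow_le_one_iff L hϖ (m : ℤ)).2 (Int.natCast_nonneg m)
  have hva1 : ValuativeRel.valuation (w.1.adicCompletion L) (a + 1) ≤ 1 := Valuation.map_add_le _ hva' (by rw [Valuation.map_one])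
  have hvals : ∀ i : Fin 2, ValuativeRel.valuation (w.1.adicCompletion L) (![a + 1, 0] i) ≤ 1 ∧
      ValuativeRel.valuation (w.1.adicCompletion L) (![-1, 1] i) ≤ 1 ∧ ValuativeRel.valuation (w.1.adicCompletion L) (![1, -1] i) ≤ 1 ∧
      ValuativeRel.valuation (w.1.adicCompletion L) (![0, a + 1] i) ≤ 1 := by
    intro i; fin_cases i <;> simp [hva1]
  have vKm : ValBound 1 Km := valBound_reindex_fromBlocks_diagonal (Fp L) L v n w (fun j => (hvals (eL j)).1) (fun j => (hvals (eL j)).2.1)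
    (fun j => (hvals (eL j)).2.2.1) (fun j => (hvals (eL j)).2.2.2)
  have vLm : ValBound 1 Lm := valBound_reindex_fromBlocks_diagonal (Fp L) L v n w (fun j => (hvals (eL j)).2.2.2) (fun j => (hvals (eL j)).2.2.1)
    (fun j => (hvals (eL j)).2.1) (fun j => (hvals (eL j)).1)
  have vfb : ∀ A : Matrix (Fin n) (Fin n) (w.1.adicCompletion L), ValBound 1 A →
      ValBound 1 (Matrix.reindex (LocalSplitting.e₂ n) (LocalSplitting.e₂ n) (Matrix.fromBlocks A 0 0 A)) := by
    intro A hA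
    refine LocalSplitting.valBound_reindex (Fp L) L v n w ?_
    rintro (i | i) (j | j)
    · exact hA i j
    · simp
    · simp
    · exact hA i j
  have vTb : ValBound 1 Tb := vfb T' fun i j => (Valuation.mem_integer_iff _ _).1 (((mem_glInt_iff T).1 hTi).1 (eL i) (eL j))
  have vTbi : ValBound 1 Tbi := vfb Ti fun i j => (Valuation.mem_integer_iff _ _).1 (((mem_glInt_iff T).1 hTi).2 (eL i) (eL j))
  have vmul : ∀ {A B : Matrix (Fin (n + n)) (Fin (n + n)) (w.1.adicCompletion L)}, ValBound 1 A → ValBound 1 B → ValBound 1 (A * B) := by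
    intro A B hA hB i j
    rw [Matrix.mul_apply]
    refine Valuation.map_sum_le _ fun l _ => ?_
    rw [map_mul]
    exact mul_le_one' (hA i l) (hB l j)
  have hk : k ∈ UnitaryGroup.localInt L (IsCMField.complexConj L) (n + n) (hermD L e dV hdV dW hdW) v := by
    rw [mem_localInt_iff_of_smul_eq (IsCMField.complexConj L) (n + n) (hermD L e dV hdV dW hdW) hc w hw k, hkw]
    refine LocalSplitting.mem_glInt_of_valBound (Fp L) L v n w (vmul (vmul vTbi vKm) vTb) ?_
    rw [hKinv]; exact vmul (vmul vTbi vLm) vTb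
  -- the `w`-component of `ι_v(t, 1)` in the frame: `Tbi · (diag(a ⊕ a⁻¹) ⊕ 1) · Tb`
  set Dm : Matrix (Fin (n + n)) (Fin (n + n)) (w.1.adicCompletion L) := Matrix.reindex (LocalSplitting.e₂ n) (LocalSplitting.e₂ n)
    (Matrix.fromBlocks (diagonal fun j => ![a, a⁻¹] (eL j)) 0 0 1) with hDm
  have hblock : Ti * diagonal (fun j => ![a, a⁻¹] (eL j)) * T' =
      (((T⁻¹ : GL (Fin 2) (w.1.adicCompletion L)) : Matrix (Fin 2) (Fin 2) (w.1.adicCompletion L)) * Matrix.diagonal ![a, a⁻¹] *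
        (T : Matrix (Fin 2) (Fin 2) (w.1.adicCompletion L))).submatrix eL eL := by
    have hD' : (Matrix.diagonal ![a, a⁻¹]).submatrix eL eL = diagonal fun j => ![a, a⁻¹] (eL j) := Matrix.submatrix_diagonal_equiv _ _
    rw [hTi', hT', ← hD', Matrix.submatrix_mul_equiv, Matrix.submatrix_mul_equiv]
  have hh : Units.val (((iotaLeftLocPi L e dV hdV dW hdW v t :
        UnitaryGroup.localPi L (IsCMField.complexConj L) (n + n) (hermD L e dV hdV dW hdW) v) :
          UnitaryGroup.LocalGLPi L (n + n) v) w) = Tbi * Dm * Tb := by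
    have h1 : Units.val (((1 : UnitaryGroup.localPi L (IsCMField.complexConj L) 2 (Matrix.diagonal dV) v) :
        UnitaryGroup.LocalGLPi L 2 v) w) = 1 := rfl
    have hre1 : Matrix.reindex e e (1 : Matrix (Fin 2 × Fin 1) (Fin 2 × Fin 1) (w.1.adicCompletion L)) = 1 := by
      rw [Matrix.reindex_apply, Matrix.submatrix_one_equiv]
    rw [iotaLeftLocPi_apply, coe_iotaVLocPi_apply, ht, h1, Matrix.one_kronecker_one, reindex_kronecker_one_eq_submatrix e, ← heL, ← hblock, hre1,
      hTbi, hDm, hTb, frame_conj_blocks, Matrix.mul_zero, Matrix.zero_mul, Matrix.mul_one, hTT']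
  -- `p := ι_v(t,1) · k⁻¹` and its `w`-component `Tbi · p̂ · Tb`
  set p : UnitaryGroup.localPi L (IsCMField.complexConj L) (n + n) (hermD L e dV hdV dW hdW) v := iotaLeftLocPi L e dV hdV dW hdW v t * k⁻¹ with hp
  have hpk : iotaLeftLocPi L e dV hdV dW hdW v t = p * k := (inv_mul_cancel_right _ _).symm
  have hpw : Units.val (((p : UnitaryGroup.localPi L (IsCMField.complexConj L) (n + n) (hermD L e dV hdV dW hdW) v) :
      UnitaryGroup.LocalGLPi L (n + n) v) w) =
      Matrix.reindex (LocalSplitting.e₂ n) (LocalSplitting.e₂ n) (Matrix.fromBlocks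
        (Ti * diagonal (fun j => ![a, a⁻¹] (eL j) * ![0, a + 1] (eL j)) * T') (Ti * diagonal (fun j => ![a, a⁻¹] (eL j) * ![1, -1] (eL j)) * T')
        (Ti * diagonal (fun j => ![-1, 1] (eL j)) * T') (Ti * diagonal (fun j => ![a + 1, 0] (eL j)) * T')) := by
    rw [hp, Subgroup.coe_mul, Pi.mul_apply, Units.val_mul, Subgroup.coe_inv, Pi.inv_apply, hkw, hKinv, hh]
    have e1 : Tbi * Dm * Tb * (Tbi * Lm * Tb) = Tbi * (Dm * Lm) * Tb := by simp only [Matrix.mul_assoc, hTb1]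
    rw [e1, hDm, hLm, dMat_mul_lMat, hTbi, hTb, frame_conj_blocks]
  -- `p ∈ P_Δ(L⁺_v)`
  have hsum : diagonal (fun j => ![a, a⁻¹] (eL j) * ![0, a + 1] (eL j)) + diagonal (fun j => ![a, a⁻¹] (eL j) * ![1, -1] (eL j)) =
      diagonal (fun j => ![-1, 1] (eL j)) + diagonal (fun j => ![a + 1, 0] (eL j)) := by
    rw [diagonal_add, diagonal_add]
    exact congrArg diagonal (funext fun j => siegel_line a ha (eL j))
  have hsum' : diagonal (fun j => ![a, a⁻¹] (eL j) * ![0, a + 1] (eL j)) + diagonal (fun j => ![a, a⁻¹] (eL j) * ![1, -1] (eL j)) =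
      diagonal (fun j => ![a, 1] (eL j)) := by
    rw [diagonal_add]
    exact congrArg diagonal (funext fun j => detDelta_line a ha (eL j))
  have hp' : p ∈ siegelDeltaLoc L e dV hdV dW hdW v := by
    rw [mem_siegelDeltaLoc_iff_isSiegelM]
    intro w'
    obtain rfl : w' = w := UnitaryGroup.PlacesOver.eq_of_smul_eq (IsCMField.complexConj L) hc w hw w'
    unfold IsSiegelM
    rw [hpw, ← Matrix.reindex_symm, Equiv.symm_apply_apply, Matrix.toBlocks_fromBlocks₁₁, Matrix.toBlocks_fromBlocks₁₂, Matrix.toBlocks_fromBlocks₂₁,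
      Matrix.toBlocks_fromBlocks₂₂, ← Matrix.add_mul, ← Matrix.mul_add, ← Matrix.add_mul, ← Matrix.mul_add, hsum]
  -- `det_Δ p_w = a`
  have hd₁ : LocalSplitting.detDelta (Fp L) L (IsCMField.complexConj L) v n w p = a := by
    simp only [LocalSplitting.detDelta, LocalSplitting.deltaBlock]
    rw [hpw, ← Matrix.reindex_symm, Equiv.symm_apply_apply, Matrix.toBlocks_fromBlocks₁₁, Matrix.toBlocks_fromBlocks₁₂, ← Matrix.add_mul,
      ← Matrix.mul_add, hsum', Matrix.det_mul, Matrix.det_mul, mul_right_comm, ← Matrix.det_mul, hTT', Matrix.det_one, one_mul, det_diagonal,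
      Fintype.prod_equiv eL (fun j => ![a, 1] (eL j)) ![a, 1] (fun _ => rfl), Fin.prod_univ_two]
    simp
  -- unfold `Λ = χ_w(det_Δ p)|det_Δ p|_w^{s+n/2}` over the single place `w`
  have hu₁ : IsUnit (LocalSplitting.detDelta (Fp L) L (IsCMField.complexConj L) v n w p) := by rw [hd₁]; exact ha.isUnit
  haveI : Subsingleton (UnitaryGroup.PlacesOver L v) := UnitaryGroup.PlacesOver.subsingleton_of_smul_eq (IsCMField.complexConj L) hc w hw
  rw [hpk, lambdaLoc_mul_eq L e dV hdV dW hdW v χ s hχ hp' hk, siegelCharLoc_eq_localSiegelCharacter_of_mem L e dV hdV dW hdW v χ s hp']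
  simp only [LocalSiegelDoubled.localSiegelCharacter, LocalSiegelDoubled.absDetDelta, LocalSplitting.chiDet]
  rw [Fintype.prod_subsingleton _ w, Fintype.prod_subsingleton _ w, dif_pos hu₁]
  have hχ₁ : ((χ.localComponent w.1 hu₁.unit : ℂˣ) : ℂ) = χ.valueAtUniformizer w.1 ^ m := by
    rw [HeckeCharacter.localComponent_apply, HeckeCharacter.coe_map_localUnits_eq_valueAtUniformizer_zpow (hχ w), IsUnit.unit_spec, hd₁, ha_def,
      neg_log_valued_pow L hϖ, zpow_natCast]
  rw [hχ₁, hd₁, ha_def, norm_pow]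

end Summit.HodgeConjecture.HodgeConjecture.Cruxes.HLiu418.K2LiuUnramifiedSectionOnCartanInert

end
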